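import Summits.BirchSwinnertonDyer.BirchSwinnertonDyer.Theorems.ThetaPartnerAtTwoSignedTransportAtTwoSharpInvariantFamilies
import Summits.BirchSwinnertonDyer.BirchSwinnertonDyer.Theorems.ThetaPartnerAtTwoSignedTransportAtTwoSurjEngine
import Mathlib.NumberTheory.Basic
import HarnessLib

/-!
# SURJ♯ at EVERY RANK by Greenberg's TWIST: the `𝒫`-currency engine run with the twisted shift `u·T` — imprimitive signed
# surjectivity from a TWISTED Cassels input and TWISTED coinvariant vanishing (item 23110 `ResidualLambdaFormulaNegDiscAtTwo`)

Route `ResidualThetaTransportAtTwo` (RTT, crux r201 `ResidualLambdaFormulaNegDiscAtTwo`, stmt-BirchSwinnertonDyer-23110) /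
`ThetaPartnerAtTwo` (TP2, aside r205; K1 line `bridge`, registered stub `stub_surj2`). Seat `prover-bsd-wall-tp2-p2x` g12
(`--supports stmt-BirchSwinnertonDyer-23110`). THEOREMS ONLY (no definition, no named fact, no `sorry`).

WHY. The all-rank door `ResidualThetaLayer.residualLambdaFormulaNegDiscAtTwo_of_surj2_of_plusDiv2` (p644772) pins 23110 to
SURJ⁺@2 ∧ DIV⁺@2 for ONE curve of ANY rank. The tree proves SURJ♯ (the `𝒫`-currency form of SURJ⁺@2) by the engine
`SignedEC.SurjEngine.le_of_fixed_le_of_le_sub_image_of_torsion` run with the SHIFT `T` on families of local classes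
(`SignedEC.sharp_localRes_surjective_of_cassels_of_coinv`, seats tp2-p3-w2 / bsd-inputs-r1-p1): its two arithmetic inputs are
CASSELS over `ℚ` (the `T`-fixed families come from `ℚ`) and COINV♯ (`(Sel♯_{S₀})_Γ = 0`), and BOTH need `Sel_{p^∞}(E/ℚ)` finite —
false in Mordell–Weil rank `≥ 2` (memo ALL-RANK-RLF-ROADS-w4g0 §2). Greenberg's remedy (LNM 1716, Lemma 4.6 p. 107 and Prop. 4.14
p. 123): twist the Galois module by `κ^s`; on `H¹(K_∞, E[p^∞])` the twisted `Γ`-action is `c ↦ u·conj_γ c` with `u = κ(γ)^s`,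
an integer `u ≡ 1 (mod p)` in the tree's convention (`Literature/…/IwasawaTwistedCoinvariantsProofs.lean`: `ψ_u = u·conj_γ − 1`).
THIS FILE re-runs the engine with the TWISTED SHIFT `u·T` (the engine is stated for an arbitrary endomorphism), for ANY number field
`K`, prime `p`, `ℤ_p`-extension `κ`, sign `ε`, element `γ`, finite set `S₀` of places prime to `p`, and `u ≡ 1 (mod p)`:

* `sharp_localRes_surjective_of_twistedCassels_of_twistedCoinv` — from
  (TCAS♯) «twisted Cassels over `K_∞` at `S₀`»: every family `(z_v)_{v ∈ S₀}` of `p`-power-torsion local classes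
  `z_v ∈ 𝒫_v = H¹(Gal(K̄_v/(K_∞)_η), E(K̄_v))` with `u^{N_v}·conj_{g_v} z_v = z_v` (twisted eigenvectors of the local generator)
  is `(loc_v c)_v` for a class `c ∈ Sel♯_{S₀}(E/K_∞)` with `u·conj_γ c = c` — Greenberg's «variant of Cassels' theorem for `A_s`»
  (Prop. 4.13 for `M = A_s` over `K`, p. 123) followed by the local `Γ`-descents;
  (TCOINV♯) «twisted coinvariant vanishing»: `ψ_u(Sel♯_{S₀}) = Sel♯_{S₀}` («`S_M(F_∞)_Γ = 0`», p. 124);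
  and the local data `N_v = p^{s_v}`, `g_v` with `γ^{N_v} ∈ Gal(K̄/K_∞)·g_v|` and `hgper` (every `p`-power-torsion local class is
  fixed by some `conj_{g_v^{p^j}}`): EVERY family `(y_{v,n})_{v ∈ S₀, n < N_v}` of `p`-power-torsion classes `y_{v,n} ∈ 𝒫_v` is
  `(loc_v(conj_{γⁿ} c))` for one `c ∈ Sel♯_{S₀}(E/K_∞)` — SURJ♯, the UNTWISTED conclusion (the twist only changes the bookkeeping
  of the `Γ`-action: «`A_s ≅ E[p^∞]` as `G_{F_∞}`-modules», p. 107).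

Mechanics of the twist in the engine (§1): `u ≡ 1 (mod p)` gives `p^{k+1} ∣ u^{p^k} − 1` (Mathlib `dvd_sub_pow_of_dvd_sub`), so
`(u·T)^{p^K}` fixes a `p^k`-torsion periodic family for `K ≫ 0`; and `u` is prime to `p`, so `uⁿ·x = 0 ⇒ x = 0` on `p`-primary `x`
(`eq_zero_of_pow_zsmul_eq_zero_of_pow_nsmul_eq_zero`), which identifies a `(u·T)`-fixed family with `(u^{-n} z_v)_n`.

HONEST FRAMING: closes nothing; (TCAS♯) and (TCOINV♯) are displayed hypotheses (research inputs at `p = 2`: Poitou–Tate over `ℚ`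
for the finite twisted modules `E[2^J](χ_u)` — tree `ZpExtension.galoisTwist`, `poitouTate_selmerStructure_duality` — plus the signed
local theory at `2`, and Greenberg's chase from `ψ_u(H¹(ℚ_Σ/ℚ_∞, E[2^∞])) = H¹(ℚ_Σ/ℚ_∞, E[2^∞])`); BSD is not proved by any of this.
References: [GreenbergLNM1716] §4 Lemma 4.6 and Remark pp. 105–108, Prop. 4.13 and Remark pp. 122–123, Prop. 4.14 pp. 123–124;
[GreenbergVatsal2000] §2 Prop. (2.1), p. 23; [Washington1997] §13.2.
-/

set_option autoImplicit false
-- the Theorems namespace of this sub repeats the summit name by design (D-0017 nested layout)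
set_option linter.dupNamespace false

noncomputable section

open scoped Classical NumberField

open NumberField IsDedekindDomain

namespace Summit.BirchSwinnertonDyer.BirchSwinnertonDyer.Theorems.SignedEC.TwistedSurj

open Literature.NumberTheory.EllipticCurves Literature.NumberTheory.GaloisRepresentations
  WeierstrassCurve ZpExtension Literature.NumberTheory.EllipticCurves.Kobayashi2003
  Literature.NumberTheory.EllipticCurves.GreenbergVatsal2000

universe u

/-! ## §1. Arithmetic of the twist `u ≡ 1 (mod p)` -/

/-- `u ≡ 1 (mod p)` is prime to every power of `p`. [folklore] -/
theorem isCoprime_pow_of_dvd_sub_one {p : ℕ} {u : ℤ} (hu : (p : ℤ) ∣ u - 1) (n k : ℕ) :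
    IsCoprime (u ^ n) ((p : ℤ) ^ k) := by
  obtain ⟨t, ht⟩ := hu
  have h1 : IsCoprime u (p : ℤ) := ⟨1, -t, by linear_combination ht⟩
  exact h1.pow

/-- On a `p`-primary element the twist `uⁿ` (`u ≡ 1 (mod p)`) is injective: `uⁿ·x = 0` and `p^k·x = 0` force `x = 0`.
[folklore] -/
theorem eq_zero_of_pow_zsmul_eq_zero_of_pow_nsmul_eq_zero {A : Type*} [AddCommGroup A] {p : ℕ} {u : ℤ}
    (hu : (p : ℤ) ∣ u - 1) {n k : ℕ} {x : A} (hux : u ^ n • x = 0) (hpx : p ^ k • x = 0) : x = 0 := by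
  obtain ⟨a, b, hab⟩ := isCoprime_pow_of_dvd_sub_one hu n k
  have hpx' : ((p : ℤ) ^ k) • x = 0 := by
    rw [← Int.natCast_pow, natCast_zsmul]; exact hpx
  calc x = (1 : ℤ) • x := (one_zsmul x).symm
    _ = (a * u ^ n + b * (p : ℤ) ^ k) • x := by rw [hab]
    _ = 0 := by rw [add_zsmul, mul_zsmul, mul_zsmul, hux, hpx', zsmul_zero, zsmul_zero, add_zero]

/-- `u ≡ 1 (mod p)` ⇒ `u^{p^K} ≡ 1 (mod p^k)` for `k ≤ K + 1`; hence `u^{p^K}` fixes every `p^k`-torsion element.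
(Mathlib `dvd_sub_pow_of_dvd_sub`: `p^{K+1} ∣ u^{p^K} − 1`.) [folklore] -/
theorem pow_pow_zsmul_eq_self_of_pow_nsmul_eq_zero {A : Type*} [AddCommGroup A] {p : ℕ} {u : ℤ}
    (hu : (p : ℤ) ∣ u - 1) {k K : ℕ} (hkK : k ≤ K + 1) {x : A} (hpx : p ^ k • x = 0) :
    u ^ p ^ K • x = x := by
  have hdvd : ((p : ℤ) ^ (K + 1)) ∣ u ^ p ^ K - 1 := by
    have h := dvd_sub_pow_of_dvd_sub hu K
    rwa [one_pow] at h
  obtain ⟨t, ht⟩ := (pow_dvd_pow (p : ℤ) hkK).trans hdvd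
  have hpx' : ((p : ℤ) ^ k) • x = 0 := by
    rw [← Int.natCast_pow, natCast_zsmul]; exact hpx
  have e : u ^ p ^ K = 1 + (p : ℤ) ^ k * t := by linear_combination ht
  rw [e, add_zsmul, one_zsmul, mul_comm, mul_zsmul, hpx', zsmul_zero, add_zero]

/-! ## §2. SURJ♯ from twisted Cassels and twisted coinvariant vanishing -/

variable {K : Type u} [Field K] [NumberField K] (W : WeierstrassCurve K) {p : ℕ} [Fact p.Prime]

set_option maxHeartbeats 400000 in
/-- **SURJ♯ at every rank from the twisted inputs** (Greenberg's Lemma 4.6 / Prop. 4.14 road, `𝒫`-currency). `K` a number field,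
`p` a prime, `κ` a `ℤ_p`-extension of `K` with `H = Gal(K̄/K_∞)`, `ε` a sign, `γ ∈ Γ_K`, `S₀` a finite set of places prime to `p`,
`u ∈ ℤ` with `p ∣ u − 1`; local data: `N_v = p^{s_v}`, `g_v ∈ Γ_{K_v}` with `γ^{N_v} ∈ H·g_v|_{K̄}` (`hg`), and every `p`-power-torsion
class of `𝒫_v = H¹(Gal(K̄_v/(K_∞)_η), E(K̄_v))` fixed by some `conj_{g_v^{p^j}}` (`hgper`). ASSUME (TCAS♯): every family of
`p`-power-torsion twisted eigenvectors `z_v ∈ 𝒫_v` (`u^{N_v}·conj_{g_v} z_v = z_v`, `v ∈ S₀`) is `(loc_v c)` for some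
`c ∈ Sel♯_{S₀}(E/K_∞)` with `u·conj_γ c = c`; and (TCOINV♯): every `s ∈ Sel♯_{S₀}` is `u·conj_γ s' − s'` with `s' ∈ Sel♯_{S₀}`.
THEN every family `(y_{v,n})_{v ∈ S₀, n < N_v}` of `p`-power-torsion classes of `𝒫_v` is `(loc_v(conj_{γⁿ} c))` for one
`c ∈ Sel♯_{S₀}(E/K_∞)`. Proof: the engine `SurjEngine.le_of_fixed_le_of_le_sub_image_of_torsion` with `T := u·(shift)` on the
`g`-quasi-periodic torsion families; the `T`-fixed families are `(u^{-n} z_v)` with `z_v` a twisted eigenvector (so (TCAS♯) realises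
them), and `(T − 1)(Φ s') = Φ(u·conj_γ s' − s')` (so (TCOINV♯) is the divisibility input).
[cite: GreenbergLNM1716, §4 Lemma 4.6 (p. 107), Prop. 4.13 Remark (p. 123), Prop. 4.14 (pp. 123–124)]
[cite: GreenbergVatsal2000, §2 Prop. (2.1) (p. 23)] -/
theorem sharp_localRes_surjective_of_twistedCassels_of_twistedCoinv (κ : ZpExtension K p) (ε : ℤˣ)
    (γ : Field.absoluteGaloisGroup K)
    (S₀ : Finset (HeightOneSpectrum (𝓞 K))) {u : ℤ} (hu : (p : ℤ) ∣ u - 1)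
    (N : HeightOneSpectrum (𝓞 K) → ℕ) (hN : ∀ v ∈ S₀, ∃ s : ℕ, N v = p ^ s)
    (g : ∀ v : HeightOneSpectrum (𝓞 K), Field.absoluteGaloisGroup (v.adicCompletion K))
    (hg : ∀ v ∈ S₀, ∃ h ∈ κ.kerSubgroup, γ ^ N v = h * resGal (K := K) (v.adicCompletion K) (g v))
    (hgper : ∀ v ∈ S₀, ∀ c : discreteH1 (localSubgroup κ.kerSubgroup (v.adicCompletion K)) (localPoints W (v.adicCompletion K)),
      (∃ k : ℕ, p ^ k • c = 0) → ∃ j : ℕ,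
        Literature.NumberTheory.EllipticCurves.conjH1 (localSubgroup κ.kerSubgroup (v.adicCompletion K))
          (localPoints W (v.adicCompletion K)) (g v ^ p ^ j) c = c)
    (htwCas : ∀ z : (∀ v : HeightOneSpectrum (𝓞 K),
        discreteH1 (localSubgroup κ.kerSubgroup (v.adicCompletion K)) (localPoints W (v.adicCompletion K))),
      (∀ v ∈ S₀, ∃ k : ℕ, p ^ k • z v = 0) →
      (∀ v ∈ S₀, u ^ N v • Literature.NumberTheory.EllipticCurves.conjH1 (localSubgroup κ.kerSubgroup (v.adicCompletion K))
          (localPoints W (v.adicCompletion K)) (g v) (z v) = z v) →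
      ∃ c ∈ unramifiedOutside κ.kerSubgroup ↥(W.geomPrimaryTorsion p) p (↑S₀ : Set (HeightOneSpectrum (𝓞 K))) ⊓
          ⨅ (v : HeightOneSpectrum (𝓞 K)) (_ : ((p : ℕ) : 𝓞 K) ∈ v.asIdeal) (σ : Field.absoluteGaloisGroup K),
            (localKummerOverOfEmb W p κ.kerSubgroup (closureEmb (K := K) (v.adicCompletion K))
              (⨆ n : ℕ, signedLocalPoints κ (v.adicCompletion K) W ε n)).comap (W.conjH1 p κ.kerSubgroup σ),
        u • W.conjH1 p κ.kerSubgroup γ c = c ∧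
          ∀ v ∈ S₀, W.localResOver p κ.kerSubgroup (v.adicCompletion K) c = z v)
    (htwCoinv : ∀ s ∈ unramifiedOutside κ.kerSubgroup ↥(W.geomPrimaryTorsion p) p (↑S₀ : Set (HeightOneSpectrum (𝓞 K))) ⊓
        ⨅ (v : HeightOneSpectrum (𝓞 K)) (_ : ((p : ℕ) : 𝓞 K) ∈ v.asIdeal) (σ : Field.absoluteGaloisGroup K),
          (localKummerOverOfEmb W p κ.kerSubgroup (closureEmb (K := K) (v.adicCompletion K))
            (⨆ n : ℕ, signedLocalPoints κ (v.adicCompletion K) W ε n)).comap (W.conjH1 p κ.kerSubgroup σ),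
      ∃ s' ∈ unramifiedOutside κ.kerSubgroup ↥(W.geomPrimaryTorsion p) p (↑S₀ : Set (HeightOneSpectrum (𝓞 K))) ⊓
        ⨅ (v : HeightOneSpectrum (𝓞 K)) (_ : ((p : ℕ) : 𝓞 K) ∈ v.asIdeal) (σ : Field.absoluteGaloisGroup K),
          (localKummerOverOfEmb W p κ.kerSubgroup (closureEmb (K := K) (v.adicCompletion K))
            (⨆ n : ℕ, signedLocalPoints κ (v.adicCompletion K) W ε n)).comap (W.conjH1 p κ.kerSubgroup σ),
        u • W.conjH1 p κ.kerSubgroup γ s' - s' = s)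
    (y : ∀ v : HeightOneSpectrum (𝓞 K), ℕ →
      discreteH1 (localSubgroup κ.kerSubgroup (v.adicCompletion K)) (localPoints W (v.adicCompletion K)))
    (hy : ∀ v ∈ S₀, ∀ n < N v, ∃ k : ℕ, p ^ k • y v n = 0) :
    ∃ c ∈ unramifiedOutside κ.kerSubgroup ↥(W.geomPrimaryTorsion p) p (↑S₀ : Set (HeightOneSpectrum (𝓞 K))) ⊓
        ⨅ (v : HeightOneSpectrum (𝓞 K)) (_ : ((p : ℕ) : 𝓞 K) ∈ v.asIdeal) (σ : Field.absoluteGaloisGroup K),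
          (localKummerOverOfEmb W p κ.kerSubgroup (closureEmb (K := K) (v.adicCompletion K))
            (⨆ n : ℕ, signedLocalPoints κ (v.adicCompletion K) W ε n)).comap (W.conjH1 p κ.kerSubgroup σ),
      ∀ v ∈ S₀, ∀ n < N v,
        W.localResOver p κ.kerSubgroup (v.adicCompletion K) (W.conjH1 p κ.kerSubgroup (γ ^ n) c) = y v n := by
  -- NOTATION
  set Ssharp := unramifiedOutside κ.kerSubgroup ↥(W.geomPrimaryTorsion p) p (↑S₀ : Set (HeightOneSpectrum (𝓞 K))) ⊓
        ⨅ (v : HeightOneSpectrum (𝓞 K)) (_ : ((p : ℕ) : 𝓞 K) ∈ v.asIdeal) (σ : Field.absoluteGaloisGroup K),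
          (localKummerOverOfEmb W p κ.kerSubgroup (closureEmb (K := K) (v.adicCompletion K))
            (⨆ n : ℕ, signedLocalPoints κ (v.adicCompletion K) W ε n)).comap (W.conjH1 p κ.kerSubgroup σ) with hSsharp
  -- the local class groups `𝒫_v`, the local conjugations `Tloc v = conj_{g_v}`
  let P : HeightOneSpectrum (𝓞 K) → Type u := fun v ↦
    discreteH1 (localSubgroup κ.kerSubgroup (v.adicCompletion K)) (localPoints W (v.adicCompletion K))
  let Tloc : ∀ v : HeightOneSpectrum (𝓞 K), P v →+ P v := fun v ↦
    Literature.NumberTheory.EllipticCurves.conjH1 (localSubgroup κ.kerSubgroup (v.adicCompletion K))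
      (localPoints W (v.adicCompletion K)) (g v)
  have hTloc_pow : ∀ (v : HeightOneSpectrum (𝓞 K)) (m : ℕ) (c : P v), (Tloc v)^[m] c =
      Literature.NumberTheory.EllipticCurves.conjH1 (localSubgroup κ.kerSubgroup (v.adicCompletion K))
        (localPoints W (v.adicCompletion K)) (g v ^ m) c := by
    intro v m
    induction m with
    | zero =>
      intro c
      rw [Function.iterate_zero, id, pow_zero, Literature.NumberTheory.EllipticCurves.conjH1_one_holds,
        AddMonoidHom.id_apply]
    | succ m ih =>
      intro c
      rw [Function.iterate_succ_apply', ih, pow_succ',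
        Literature.NumberTheory.EllipticCurves.conjH1_mul_holds, AddMonoidHom.comp_apply]
  -- powers of `conj_γ` against the twist: `u·conj_γ c = c ⇒ uⁿ·conj_{γⁿ} c = c`
  have hconj_pow : ∀ c : W.subgroupH1 p κ.kerSubgroup, u • W.conjH1 p κ.kerSubgroup γ c = c →
      ∀ n : ℕ, u ^ n • W.conjH1 p κ.kerSubgroup (γ ^ n) c = c := by
    intro c hc n
    induction n with
    | zero => rw [pow_zero, one_zsmul, pow_zero, W.conjH1_one_holds p κ.kerSubgroup, AddMonoidHom.id_apply]
    | succ n ih =>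
      rw [pow_succ, pow_succ, W.conjH1_mul_holds p κ.kerSubgroup, AddMonoidHom.comp_apply, mul_zsmul,
        ← map_zsmul (W.conjH1 p κ.kerSubgroup (γ ^ n)), hc, ih]
  -- the ambient group of families, the shift `τ` and the twisted shift `T = u·τ`
  let F : Type u := ∀ v : ↥S₀, ℕ → P v.1
  let τ : F →+ F :=
    { toFun := fun f v n ↦ f v (n + 1)
      map_zero' := rfl
      map_add' := fun _ _ ↦ rfl }
  let T : Module.End ℤ F := u • τ.toIntLinearMap
  have hτ : ∀ (f : F) (v : ↥S₀) (n : ℕ), τ f v n = f v (n + 1) := fun _ _ _ ↦ rfl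
  have hT : ∀ (f : F) (v : ↥S₀) (n : ℕ), T f v n = u • f v (n + 1) := fun _ _ _ ↦ rfl
  have hTpow : ∀ (m : ℕ) (f : F) (v : ↥S₀) (n : ℕ), (T ^ m) f v n = u ^ m • f v (n + m) := by
    intro m
    induction m with
    | zero => intro f v n; rw [pow_zero, Module.End.one_apply, pow_zero, one_zsmul, add_zero]
    | succ m ih =>
      intro f v n
      rw [pow_succ, Module.End.mul_apply, ih, hT, smul_smul, ← pow_succ, add_assoc]
  -- the subgroup `G₀` of `g`-quasi-periodic, uniformly `p`-power-torsion families
  let G₀ : AddSubgroup F :=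
    { carrier := {f | (∀ (v : ↥S₀) (n : ℕ), f v (n + N v) = Tloc v (f v n)) ∧ ∃ k : ℕ, ∀ (v : ↥S₀) (n : ℕ), p ^ k • f v n = 0}
      add_mem' := by
        rintro a b ⟨ha1, ka, ha2⟩ ⟨hb1, kb, hb2⟩
        refine ⟨fun v n ↦ ?_, ka + kb, fun v n ↦ ?_⟩
        · change a v (n + N v) + b v (n + N v) = Tloc v (a v n + b v n)
          rw [map_add, ha1, hb1]
        · change p ^ (ka + kb) • (a v n + b v n) = 0
          rw [smul_add, pow_add, mul_comm, mul_smul, ha2, smul_zero, mul_comm, mul_smul, hb2, smul_zero, add_zero]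
      zero_mem' := ⟨fun v n ↦ by change (0 : P v) = Tloc v 0; rw [map_zero], 0, fun v n ↦ smul_zero _⟩
      neg_mem' := by
        rintro a ⟨ha1, ka, ha2⟩
        refine ⟨fun v n ↦ ?_, ka, fun v n ↦ ?_⟩
        · change -a v (n + N v) = Tloc v (-a v n)
          rw [map_neg, ha1]
        · change p ^ ka • (-a v n) = 0
          rw [smul_neg, ha2, neg_zero] }
  have hG₀ : ∀ f : F, f ∈ G₀ ↔
      (∀ (v : ↥S₀) (n : ℕ), f v (n + N v) = Tloc v (f v n)) ∧ ∃ k : ℕ, ∀ (v : ↥S₀) (n : ℕ), p ^ k • f v n = 0 :=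
    fun f ↦ Iff.rfl
  -- quasi-periodicity iterated
  have hqp : ∀ f ∈ G₀, ∀ (v : ↥S₀) (q r : ℕ), f v (r + N v * q) = (Tloc v)^[q] (f v r) := by
    intro f hf v q
    induction q with
    | zero => intro r; rw [mul_zero, add_zero, Function.iterate_zero, id]
    | succ q ih =>
      intro r
      rw [Nat.mul_succ, ← add_assoc, ((hG₀ f).mp hf).1, ih, Function.iterate_succ_apply']
  -- the detecting map `Φ : c ↦ (loc_v conj_{γⁿ} c)`
  let Φ : W.subgroupH1 p κ.kerSubgroup →+ F :=
    { toFun := fun c v n ↦ W.localResOver p κ.kerSubgroup (v.1.adicCompletion K) (W.conjH1 p κ.kerSubgroup (γ ^ n) c)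
      map_zero' := by funext v n; simp only [map_zero]; rfl
      map_add' := fun a b ↦ by funext v n; simp only [map_add]; rfl }
  have hΦ : ∀ c (v : ↥S₀) n, Φ c v n =
      W.localResOver p κ.kerSubgroup (v.1.adicCompletion K) (W.conjH1 p κ.kerSubgroup (γ ^ n) c) := fun _ _ _ ↦ rfl
  -- `Φ (conj_γ c) = τ (Φ c)`
  have hΦconj : ∀ c, Φ (W.conjH1 p κ.kerSubgroup γ c) = τ (Φ c) := by
    intro c
    funext v n
    change W.localResOver p κ.kerSubgroup (v.1.adicCompletion K)
        (W.conjH1 p κ.kerSubgroup (γ ^ n) (W.conjH1 p κ.kerSubgroup γ c)) =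
      W.localResOver p κ.kerSubgroup (v.1.adicCompletion K) (W.conjH1 p κ.kerSubgroup (γ ^ (n + 1)) c)
    rw [pow_succ, W.conjH1_mul_holds p κ.kerSubgroup, AddMonoidHom.comp_apply]
  -- `Φ c` is quasi-periodic: `conj_{γ^{N_v}} = conj_{h·g_v|}` and localisation is `D_v`-equivariant
  have hΦqp : ∀ c (v : ↥S₀) (n : ℕ), Φ c v (n + N v) = Tloc v (Φ c v n) := by
    intro c v n
    obtain ⟨h, hh, hgv⟩ := hg v.1 v.2
    rw [hΦ, hΦ, pow_add, W.conjH1_mul_holds p κ.kerSubgroup, AddMonoidHom.comp_apply]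
    -- `conj_{γⁿ}` and `conj_{γ^N}` commute
    have hcomm : W.conjH1 p κ.kerSubgroup (γ ^ n) (W.conjH1 p κ.kerSubgroup (γ ^ N v) c) =
        W.conjH1 p κ.kerSubgroup (γ ^ N v) (W.conjH1 p κ.kerSubgroup (γ ^ n) c) := by
      rw [← AddMonoidHom.comp_apply, ← W.conjH1_mul_holds p κ.kerSubgroup, ← pow_add, add_comm, pow_add,
        W.conjH1_mul_holds p κ.kerSubgroup, AddMonoidHom.comp_apply]
    rw [hcomm, hgv, W.conjH1_mul_holds p κ.kerSubgroup, AddMonoidHom.comp_apply, W.conjH1_of_mem_holds p κ.kerSubgroup hh,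
      AddMonoidHom.id_apply, WeierstrassCurve.localResOver_conjH1_resGal]
  -- the image `I` of `Sel♯_{S₀}` and `I ≤ G₀`
  let I : AddSubgroup F := Ssharp.map Φ
  have hI : ∀ f : F, f ∈ I ↔ ∃ c ∈ Ssharp, Φ c = f := fun f ↦ AddSubgroup.mem_map
  have hIG : I ≤ G₀ := by
    intro f hf
    obtain ⟨c, hc, rfl⟩ := (hI f).mp hf
    refine (hG₀ _).mpr ⟨fun v n ↦ hΦqp c v n, ?_⟩
    obtain ⟨k, hk⟩ := W.exists_pow_smul_subgroupH1_ker_eq_zero κ c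
    refine ⟨k, fun v n ↦ ?_⟩
    rw [hΦ, ← map_nsmul, ← map_nsmul, hk, map_zero, map_zero]
  -- `T` preserves `G₀`
  have hTG : ∀ f ∈ G₀, T f ∈ G₀ := by
    intro f hf
    obtain ⟨h1, k, h2⟩ := (hG₀ f).mp hf
    refine (hG₀ _).mpr ⟨fun v n ↦ ?_, k, fun v n ↦ ?_⟩
    · rw [hT, hT, add_right_comm, h1, map_zsmul]
    · rw [hT, smul_comm, h2 v (n + 1), zsmul_zero]
  -- every `f ∈ G₀` is fixed by some `T^{p^K}`
  have hper : ∀ f ∈ G₀, ∃ K : ℕ, (T ^ p ^ K) f = f := by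
    intro f hf
    obtain ⟨h1, k, h2⟩ := (hG₀ f).mp hf
    -- a uniform exponent `J` with `conj_{g_v^{p^J}}` fixing `f v n`, `n < N v`
    obtain ⟨J, hJ⟩ := exists_uniform_nat (ι := ↥S₀) (fun v ↦ N v)
      (fun v n j ↦ Literature.NumberTheory.EllipticCurves.conjH1 (localSubgroup κ.kerSubgroup (v.1.adicCompletion K))
        (localPoints W (v.1.adicCompletion K)) (g v ^ p ^ j) (f v n) = f v n)
      (fun v n j j' hjj' hfix ↦ by
        have e : g v.1 ^ p ^ j' = (g v.1 ^ p ^ j) ^ p ^ (j' - j) := by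
          rw [← pow_mul, ← pow_add, Nat.add_sub_cancel' hjj']
        rw [e]
        exact conjH1_pow_eq_self _ _ hfix _)
      (fun v n _ ↦ hgper v.1 v.2 (f v n) ⟨k, h2 v n⟩)
    -- exponents of the `N v`
    have hs : ∀ v : ↥S₀, ∃ s : ℕ, N v = p ^ s := fun v ↦ hN v.1 v.2
    obtain ⟨S, hS'⟩ := exists_uniform_nat (ι := ↥S₀) (fun _ ↦ 1) (fun v _ s ↦ N v ∣ p ^ s)
      (fun v n s s' hss' hd ↦ hd.trans (pow_dvd_pow p hss')) (fun v n _ ↦ by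
        obtain ⟨s, hs⟩ := hs v; exact ⟨s, by rw [hs]⟩)
    refine ⟨S + J + k, ?_⟩
    funext v n
    rw [hTpow]
    obtain ⟨m, hm⟩ := hS' v 0 Nat.one_pos
    have hNpos : 0 < N v := by obtain ⟨s, hs⟩ := hs v; rw [hs]; exact pow_pos (Fact.out : p.Prime).pos s
    -- `f v` has period `N v * p^J`
    have hperiod : ∀ r : ℕ, f v (r + N v * p ^ J) = f v r := by
      intro r
      have hr : r = r % N v + N v * (r / N v) := (Nat.mod_add_div r (N v)).symm
      rw [hr, add_assoc, ← mul_add, hqp f hf, hqp f hf, Function.iterate_add_apply, hTloc_pow v (p ^ J)]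
      · congr 1
        exact hJ v (r % N v) (Nat.mod_lt r hNpos)
    have e : p ^ (S + J + k) = N v * p ^ J * (p ^ S / N v * p ^ k) := by
      rw [pow_add, pow_add, hm, Nat.mul_div_cancel_left _ hNpos]
      ring
    -- iterate the period
    have hmult : ∀ q r : ℕ, f v (r + N v * p ^ J * q) = f v r := by
      intro q
      induction q with
      | zero => intro r; rw [mul_zero, add_zero]
      | succ q ih => intro r; rw [Nat.mul_succ, ← add_assoc, hperiod, ih]
    have hper' : f v (n + p ^ (S + J + k)) = f v n := by rw [e, hmult]
    rw [hper']
    -- the twist `u^{p^{S+J+k}}` fixes the `p^k`-torsion value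
    exact pow_pow_zsmul_eq_self_of_pow_nsmul_eq_zero hu (by omega) (h2 v n)
  -- uniform torsion
  have htor : ∀ f ∈ G₀, ∃ j : ℕ, p ^ j • f = 0 := by
    intro f hf
    obtain ⟨-, k, h2⟩ := (hG₀ f).mp hf
    exact ⟨k, funext fun v ↦ funext fun n ↦ h2 v n⟩
  -- `I_{ψ_u} = 0`: twisted coinvariant vanishing
  have hcoinv : ∀ i ∈ I, ∃ j ∈ I, T j - j = i := by
    intro i hi
    obtain ⟨s, hs, rfl⟩ := (hI i).mp hi
    obtain ⟨s', hs', hss'⟩ := htwCoinv s hs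
    refine ⟨Φ s', (hI _).mpr ⟨s', hs', rfl⟩, ?_⟩
    have e : T (Φ s') = Φ (u • W.conjH1 p κ.kerSubgroup γ s') := by
      rw [map_zsmul, hΦconj]; rfl
    rw [e, ← map_sub, hss']
  -- the `T`-fixed families come from twisted-invariant classes (TCAS♯)
  have hfix : ∀ f ∈ G₀, T f = f → f ∈ I := by
    intro f hf hTf
    obtain ⟨h1, k, h2⟩ := (hG₀ f).mp hf
    -- `uⁿ • f v n = f v 0`
    have hgeom : ∀ (v : ↥S₀) (n : ℕ), u ^ n • f v n = f v 0 := by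
      intro v n
      induction n with
      | zero => rw [pow_zero, one_zsmul]
      | succ n ih =>
        have e := congrArg (fun F' : F ↦ F' v n) hTf
        rw [hT] at e
        rw [pow_succ, mul_zsmul, e, ih]
    -- the value at `0` is a twisted eigenvector of `conj_{g_v}`
    have heig : ∀ v : ↥S₀, u ^ N v • Tloc v (f v 0) = f v 0 := by
      intro v
      have e := h1 v 0
      rw [zero_add] at e
      rw [← e, hgeom v (N v)]
    -- the family of values at `0` (junk off `S₀`)
    have hzdata : ∃ z : ∀ v : HeightOneSpectrum (𝓞 K), P v, ∀ v, z v = if hv : v ∈ S₀ then f ⟨v, hv⟩ 0 else 0 :=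
      ⟨_, fun _ ↦ rfl⟩
    obtain ⟨z, hz⟩ := hzdata
    have hzS : ∀ (v : HeightOneSpectrum (𝓞 K)) (hv : v ∈ S₀), z v = f ⟨v, hv⟩ 0 := fun v hv ↦ by rw [hz v, dif_pos hv]
    obtain ⟨c, hcS, hcu, hcz⟩ := htwCas z (fun v hv ↦ ⟨k, by rw [hzS v hv]; exact h2 ⟨v, hv⟩ 0⟩)
      (fun v hv ↦ by rw [hzS v hv]; exact heig ⟨v, hv⟩)
    refine (hI f).mpr ⟨c, hcS, ?_⟩
    funext v n
    -- `uⁿ • (Φ c v n − f v n) = 0`, both `p`-power torsion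
    obtain ⟨kc, hkc⟩ := W.exists_pow_smul_subgroupH1_ker_eq_zero κ c
    have hΦtor : p ^ kc • Φ c v n = 0 := by
      rw [hΦ, ← map_nsmul, ← map_nsmul, hkc, map_zero, map_zero]
    have hdiff : u ^ n • (Φ c v n - f v n) = 0 := by
      rw [zsmul_sub, hgeom v n, hΦ, ← map_zsmul (W.localResOver p κ.kerSubgroup (v.1.adicCompletion K)),
        hconj_pow c hcu n, hcz v.1 v.2, hzS v.1 v.2, sub_self]
    have htor2 : p ^ (kc + k) • (Φ c v n - f v n) = 0 := by
      rw [smul_sub, pow_add, mul_comm, mul_smul, hΦtor, smul_zero, mul_comm, mul_smul, h2 v n, smul_zero, sub_zero]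
    exact sub_eq_zero.mp (eq_zero_of_pow_zsmul_eq_zero_of_pow_nsmul_eq_zero hu hdiff htor2)
  -- THE ENGINE: `G₀ ≤ I`
  have hGI : G₀ ≤ I :=
    SurjEngine.le_of_fixed_le_of_le_sub_image_of_torsion p T I G₀ hIG hTG hper htor hfix hcoinv
  -- the target family, extended `g`-quasi-periodically
  obtain ⟨k₀, hk₀⟩ := exists_uniform_nat (ι := ↥S₀) (fun v ↦ N v) (fun v n k ↦ p ^ k • y v.1 n = 0)
    (fun v n k k' hkk' hk ↦ by
      rw [← Nat.add_sub_cancel' hkk', pow_add, mul_comm, mul_smul, hk, smul_zero])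
    (fun v n hn ↦ hy v.1 v.2 n hn)
  have hNpos : ∀ v : ↥S₀, 0 < N v := fun v ↦ by
    obtain ⟨s, hs⟩ := hN v.1 v.2; rw [hs]; exact pow_pos (Fact.out : p.Prime).pos s
  have hfdata : ∃ f : F, ∀ v n, f v n = (Tloc v)^[n / N v] (y v.1 (n % N v)) := ⟨_, fun _ _ ↦ rfl⟩
  obtain ⟨f, hf⟩ := hfdata
  have hfG : f ∈ G₀ := by
    refine (hG₀ f).mpr ⟨fun v n ↦ ?_, k₀, fun v n ↦ ?_⟩
    · rw [hf, hf, Nat.add_div_right _ (hNpos v), Nat.add_mod_right, Function.iterate_succ_apply']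
    · rw [hf, hTloc_pow, ← map_nsmul, hk₀ v (n % N v) (Nat.mod_lt _ (hNpos v)), map_zero]
  obtain ⟨c, hc, hcf⟩ := (hI f).mp (hGI hfG)
  refine ⟨c, hc, fun v hv n hn ↦ ?_⟩
  have e := congrArg (fun F' : F ↦ F' ⟨v, hv⟩ n) hcf
  rw [hΦ, hf, Nat.div_eq_of_lt hn, Nat.mod_eq_of_lt hn, Function.iterate_zero, id] at e
  exact e

end Summit.BirchSwinnertonDyer.BirchSwinnertonDyer.Theorems.SignedEC.TwistedSurj

end
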